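import Literature.NumberTheory.Rogawski1990.LocalNormFibreNonsplit                 -- ★ `charpoly_endoEmbLocal`, `finCharpolyTwo`, `finGammaTwo`
import Literature.NumberTheory.Automorphic.UnitaryGroupNonsplitPlace                -- ★ `LocalRing.isField_of_smul_eq`
import Literature.NumberTheory.Automorphic.LocalUnitaryGroupCongr                   -- ★ `adelicForm_map_adeleToLocal`
import Literature.NumberTheory.Rogawski1990.UnitStableOrbitalIntegralIrredOneClass   -- ★ `isUnit_det_adelicForm_antidiagTwo_local` (`det (Φ₂)_v` a unit)
import HarnessLib

/-!
# The SCALAR-BLOCK PARTNER `ε♭ = (u·1₂, b)` of an `H`-regular, `G`-singular `ε_H = (A, u) ∈ H_v = U(Φ₂)(L⁺_v) × U(Φ₁)(L⁺_v)`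
# (non-split `v`; Rogawski 1990 §4.3 p. 42, §8.2 Prop. 8.2.1 (c); Langlands–Shelstad descent §2.4)

Topic `NumberTheory/Rogawski1990`; namespace `Literature.NumberTheory.Rogawski1990`.  THEOREMS ONLY (existence form; no definition, no instance, no notation, no
named fact, no `sorry`).  Cell `pub/hodgecm-mathlib`, ENGINE T1 (crux H413 = `stmt-HodgeConjecture-24833`); floor-1∕2 preparation, count-neutral, for the pay-down line
«N6nsGerm» (`Cruxes/H413/Lines/F0_P3a_N6nsGerm.lean`, stub `stub_N6nsS2`): F0P2-p02 (g8)'s junction census `CENSUS-N6nsS2-junction` (6e3491ee) §2 binder **T2**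
(the central dock ★ `exists_centralDock_of_fst_eq_smul_one`, `LocalEndoscopicCentralDockCM`, is applied at the point `ε♭` NAMED by this file); author F0P2-p06 (g6).

THE MATHEMATICS.  At a non-split `v` (`∏_{w∣v} L_w` a field) let `ε_H = (A, u)` with `A ∈ U(Φ₂)(L⁺_v)` regular semisimple (`χ_A` separable, ★ `IsRegularElt`) but `ι_v(ε_H)` NOT
regular (`χ_{ι(ε_H)} = χ_A · (X − u)`, ★ `charpoly_endoEmbLocal`, inseparable).  Then `(X − u) ∣ χ_A` (else `χ_A · (X − u)` would be separable), so `u` is an eigenvalue of `A` and,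
with `b := tr A − u`, `χ_A = (X − u)(X − b)`, `u b = det A`, `b ≠ u` (separability).  Unitarity: `ū u = 1` (`u ∈ U(Φ₁)`), `\\overline{det A}·det A = 1` (`A ∈ U(Φ₂)`,
`det Φ₂` a unit) hence `b̄ b = 1`; so `ε♭ := (u·1₂, b) ∈ H_v`, a SCALAR-BLOCK element (`ε♭.1 = u·1₂`, `u ≠ b`) with `χ_{ι(ε♭)} = (X − u)²(X − b) = χ_{ι(ε_H)}` — the point at
which the (α′)∕(α″) junctions dock `H_v ≃ₜ* Z_{G′_v}(ε)`.

* §1 (polynomial algebra over a field `K`): `eval_eq_zero_of_separable_of_not_separable_mul_X_sub_C`, `charpoly_two_eq_mul_of_isRoot` (`χ_A = (X − u)(X − (tr A − u))`, `u(tr A − u) = det A`),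
  `ne_of_separable_mul_self` (`(X−u)(X−b)` separable ⇒ `b ≠ u`).
* §2 (CM carriers): `conj_mul_self_eq_one_of_local_one` (`ū u = 1` for `U(Φ₁)_v`), `conj_det_mul_det_eq_one_of_local_two` (`\\overline{det A} det A = 1` for `U(Φ₂)_v`, over ★ `isUnit_det_adelicForm_antidiagTwo_local`),
  `smul_one_mem_unitaryGroupOfForm` ∕ `isUnit_det_smul_one` (membership of `u·1₂`, `b·1₁`), **`exists_scalarBlockPartner`** (the head: `∃ b ε♭, ε♭.1.val.val = u • 1 ∧ finGammaTwo ε♭ = b ∧ b ≠ u ∧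
  finCharpolyTwo ε_H = (X − C u) * (X − C b) ∧ charpoly ι(ε♭) = charpoly ι(ε_H)`).
HONEST LABEL: HC_CM is proved only modulo the printed citations (2 remaining named inputs hLiu418, h413) until rung 0 closes; this file is linear algebra over ★ modules and pays
nothing by itself.

## References
* [Rogawski1990] J. D. Rogawski, *Automorphic Representations of Unitary Groups in Three Variables*, Ann. of Math. Stud. 123 (1990), §4.3 p. 42 (`G`-regular elements of `H`),
  §8.2 Prop. 8.2.1 (c) pp. 113–115 (the `H`-regular, `G`-singular elements `γ₁ = γ₂ ≠ γ₃`), §4.9 p. 55.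
* [LanglandsShelstad1990Descent] R. Langlands, D. Shelstad, *Descent for transfer factors* (1990), §2.4.
-/

set_option autoImplicit false

noncomputable section

open NumberField IsDedekindDomain Matrix Polynomial
open scoped MatrixGroups

namespace Literature.NumberTheory.Rogawski1990

open Literature.NumberTheory.Automorphic Literature.NumberTheory.Automorphic.UnitaryGroup

/-! ## §1 Polynomial algebra over a field -/

section Poly

variable {K : Type*} [Field K]

/-- If `f` is separable but `f · (X − u)` is not, then `u` is a root of `f` (`X − u` is irreducible, so coprime to `f` unless it divides it; coprime separable
factors have a separable product). [cite: Rogawski1990, §4.3 p. 42] -/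
theorem eval_eq_zero_of_separable_of_not_separable_mul_X_sub_C {f : K[X]} (hf : f.Separable) (u : K) (h : ¬ (f * (X - C u)).Separable) : f.eval u = 0 := by
  have hdvd : (X - C u) ∣ f := by
    by_contra hnd
    exact h (hf.mul separable_X_sub_C (((irreducible_X_sub_C u).coprime_iff_not_dvd.2 hnd).symm))
  exact (dvd_iff_isRoot.1 hdvd).eq_zero

/-- For a `2 × 2` matrix `A` with `χ_A(u) = 0`: `χ_A = (X − u)(X − (tr A − u))` and `u · (tr A − u) = det A`. [cite: Rogawski1990, §4.9 p. 55] -/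
theorem charpoly_two_eq_mul_of_isRoot (A : Matrix (Fin 2) (Fin 2) K) {u : K} (hu : A.charpoly.eval u = 0) :
    A.charpoly = (X - C u) * (X - C (A.trace - u)) ∧ u * (A.trace - u) = A.det := by
  rw [Matrix.charpoly_fin_two] at hu ⊢
  simp only [eval_add, eval_sub, eval_mul, eval_pow, eval_X, eval_C] at hu
  have hdet : u * (A.trace - u) = A.det := by linear_combination -hu
  refine ⟨?_, hdet⟩
  rw [← hdet, map_mul, map_sub]
  ring

/-- If `(X − u)(X − b)` is separable then `b ≠ u`. [cite: Rogawski1990, §4.3 p. 42] -/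
theorem ne_of_separable_mul {u b : K} (h : ((X - C u) * (X - C b)).Separable) : b ≠ u := by
  rintro rfl
  exact not_isUnit_X_sub_C b ((isCoprime_self).1 h.isCoprime)

end Poly

/-! ## §2 The CM carriers at a non-split place -/

section CM

variable (L : Type) [Field L] [NumberField L] [IsCMField L] (v : HeightOneSpectrum (𝓞 ↥(maximalRealSubfield L)))

omit [IsCMField L] in
/-- The local form of `U(Φ₁)_v` is the `1 × 1` matrix `(1)` (entry form). [cite: Rogawski1990, §4.9 p. 54] -/
theorem localForm_one_apply :
    (adeleToLocal L v) ((adelicForm L 1 (Matrix.of fun i j : Fin 1 => if i.val + j.val + 1 = 1 then (1 : L) else 0)) 0 0) = 1 := by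
  have h := congrFun (congrFun (adelicForm_map_adeleToLocal L v (Matrix.of fun i j : Fin 1 => if i.val + j.val + 1 = 1 then (1 : L) else 0)) 0) 0
  rw [Matrix.map_apply, Matrix.map_apply, Matrix.of_apply] at h
  rw [h]
  simp

/-- **`ū u = 1` for `(u) ∈ U(Φ₁)(L⁺_v)`.** [cite: Rogawski1990, §4.9 p. 54] -/
theorem conj_mul_self_eq_one_of_local_one
    (g : (cmDatum L 1 (Matrix.of fun i j : Fin 1 => if i.val + j.val + 1 = 1 then (1 : L) else 0)).Local v) :
    conjLocal L (IsCMField.complexConj L) v (g.val.val 0 0) * g.val.val 0 0 = 1 := by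
  have h := mem_unitaryGroupOfForm_iff.1 g.2
  have h00 := congrFun (congrFun h 0) 0
  simp only [Matrix.mul_apply, Fin.sum_univ_one, Matrix.transpose_apply, Matrix.map_apply, localForm_one_apply, mul_one] at h00
  exact h00

/-- **`\overline{det A} · det A = 1` for `A ∈ U(Φ₂)(L⁺_v)`** (determinant of `ᵗĀ Φ₂ A = Φ₂`, `det Φ₂` a unit). [cite: Rogawski1990, §4.9 p. 54] -/
theorem conj_det_mul_det_eq_one_of_local_two
    (g : (cmDatum L 2 (Matrix.of fun i j : Fin 2 => if i.val + j.val + 1 = 2 then (1 : L) else 0)).Local v) :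
    conjLocal L (IsCMField.complexConj L) v g.val.val.det * g.val.val.det = 1 := by
  have h := congrArg Matrix.det (mem_unitaryGroupOfForm_iff.1 g.2)
  rw [Matrix.det_mul, Matrix.det_mul, Matrix.det_transpose, ← RingHom.mapMatrix_apply, ← RingHom.map_det] at h
  have hJ := isUnit_det_adelicForm_antidiagTwo_local L v
  -- `σ(det g) * det J * det g = det J`
  have h' : ((adelicForm L 2 (Matrix.of fun i j : Fin 2 => if i.val + j.val + 1 = 2 then (1 : L) else 0)).map (adeleToLocal L v)).det *
      (conjLocal L (IsCMField.complexConj L) v g.val.val.det * g.val.val.det) =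
      ((adelicForm L 2 (Matrix.of fun i j : Fin 2 => if i.val + j.val + 1 = 2 then (1 : L) else 0)).map (adeleToLocal L v)).det * 1 := by
    rw [mul_one]
    calc _ = conjLocal L (IsCMField.complexConj L) v g.val.val.det *
          ((adelicForm L 2 (Matrix.of fun i j : Fin 2 => if i.val + j.val + 1 = 2 then (1 : L) else 0)).map (adeleToLocal L v)).det * g.val.val.det := by ring
      _ = _ := h
  exact hJ.mul_left_cancel h'

/-- **A unitary scalar matrix `u·1` lies in every `U(σ, J)`** (`σ(u) u = 1`): `ᵗ(σ(u·1)) J (u·1) = (σ(u) u)·J = J`. [cite: Rogawski1990, §4.9 p. 54] -/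
theorem smul_one_mem_unitaryGroupOfForm {R : Type*} [CommRing R] {n : Type*} [Fintype n] [DecidableEq n] (σ : R →+* R) (J : Matrix n n R) {u : R}
    (hu : σ u * u = 1) (hdet : IsUnit (u • (1 : Matrix n n R)).det) :
    Matrix.GeneralLinearGroup.mk'' (u • (1 : Matrix n n R)) hdet ∈ unitaryGroupOfForm σ J := by
  rw [mem_unitaryGroupOfForm_iff]
  change ((u • (1 : Matrix n n R)).map σ)ᵀ * J * (u • (1 : Matrix n n R)) = J
  have hmap : (u • (1 : Matrix n n R)).map σ = σ u • (1 : Matrix n n R) := by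
    rw [Matrix.smul_one_eq_diagonal, Matrix.diagonal_map (map_zero _), Matrix.smul_one_eq_diagonal]
  rw [hmap, Matrix.transpose_smul, Matrix.transpose_one, Matrix.smul_mul, Matrix.one_mul, Matrix.mul_smul, Matrix.mul_one, smul_smul,
    mul_comm u, hu, one_smul]

/-- `det (u·1ₙ) = uⁿ` is a unit for a unit `u`. [cite: Rogawski1990, §4.9 p. 54] -/
theorem isUnit_det_smul_one {R : Type*} [CommRing R] {n : Type*} [Fintype n] [DecidableEq n] {u : R} (hu : IsUnit u) :
    IsUnit (u • (1 : Matrix n n R)).det := by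
  rw [Matrix.det_smul, Matrix.det_one, mul_one]
  exact hu.pow _

/-- **THE SCALAR-BLOCK PARTNER.**  At a NON-SPLIT finite place `v` (`w ∣ v`, `w̄ = w`), for `ε_H = (A, u) ∈ H_v` with `A` regular semisimple (★ `IsRegularElt`) and
`ι_v(ε_H)` NOT regular (★ `IsLocalGRegular` fails): there are `b ∈ ∏_{w∣v} L_w` and `ε♭ ∈ H_v` with `ε♭.1 = u·1₂` (as a matrix), `U(Φ₁)`-entry `b`, `b ≠ u`,
`χ_A = (X − u)(X − b)` (★ `finCharpolyTwo`, ★ `finGammaTwo`) and `χ_{ι(ε♭)} = χ_{ι(ε_H)}` — the point at which ★ `exists_centralDock_of_fst_eq_smul_one` docks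
`H_v ≃ₜ* Z_{G′_v}(ε)` for the (α″) torus–singular junction. [cite: Rogawski1990, §4.3 p. 42; §8.2 Prop. 8.2.1 (c) p. 113; §4.9 p. 55] [cite: LanglandsShelstad1990Descent, §2.4] -/
theorem exists_scalarBlockPartner (w : PlacesOver L v) (hw : IsCMField.complexConj L • w.1 = w.1)
    (εH : (cmDatum L 2 (Matrix.of fun i j : Fin 2 => if i.val + j.val + 1 = 2 then (1 : L) else 0)).Local v ×
      (cmDatum L 1 (Matrix.of fun i j : Fin 1 => if i.val + j.val + 1 = 1 then (1 : L) else 0)).Local v)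
    (hregA : IsRegularElt (εH.1.val : GL (Fin 2) (LocalRing L v))) (hsing : ¬ IsLocalGRegular L v εH) :
    ∃ (b : LocalRing L v) (εb : (cmDatum L 2 (Matrix.of fun i j : Fin 2 => if i.val + j.val + 1 = 2 then (1 : L) else 0)).Local v ×
        (cmDatum L 1 (Matrix.of fun i j : Fin 1 => if i.val + j.val + 1 = 1 then (1 : L) else 0)).Local v),
      εb.1.val.val = finGammaTwo L v εH • 1 ∧ finGammaTwo L v εb = b ∧ b ≠ finGammaTwo L v εH ∧
        finCharpolyTwo L v εH = (X - C (finGammaTwo L v εH)) * (X - C b) ∧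
        ((endoEmbLocal L v εb).val.val : Matrix (Fin 3) (Fin 3) (LocalRing L v)).charpoly =
          ((endoEmbLocal L v εH).val.val : Matrix (Fin 3) (Fin 3) (LocalRing L v)).charpoly := by
  haveI : Algebra.IsQuadraticExtension ↥(maximalRealSubfield L) L := IsCMField.isQuadraticExtension L
  letI : Field (LocalRing L v) := (LocalRing.isField_of_smul_eq (IsCMField.complexConj L) (IsCMField.complexConj_ne_one L) w hw).toField
  -- `u` is a root of `χ_A`
  have hsep : (finCharpolyTwo L v εH).Separable := hregA
  have hns : ¬ (finCharpolyTwo L v εH * (X - C (finGammaTwo L v εH))).Separable := by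
    rw [← charpoly_endoEmbLocal]; exact hsing
  have hroot := eval_eq_zero_of_separable_of_not_separable_mul_X_sub_C hsep _ hns
  obtain ⟨hfac, hdet⟩ := charpoly_two_eq_mul_of_isRoot (εH.1.val.val) hroot
  set u := finGammaTwo L v εH with hu_def
  set b := (εH.1.val.val : Matrix (Fin 2) (Fin 2) (LocalRing L v)).trace - u with hb_def
  have hbu : b ≠ u := ne_of_separable_mul (by rw [← hfac]; exact hsep)
  -- unitarity of `u` and `b`
  have hu1 : conjLocal L (IsCMField.complexConj L) v u * u = 1 := conj_mul_self_eq_one_of_local_one L v εH.2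
  have hb1 : conjLocal L (IsCMField.complexConj L) v b * b = 1 := by
    have h := conj_det_mul_det_eq_one_of_local_two L v εH.1
    rw [← hdet, map_mul] at h
    calc conjLocal L (IsCMField.complexConj L) v b * b = (conjLocal L (IsCMField.complexConj L) v b * b) * (conjLocal L (IsCMField.complexConj L) v u * u) := by
          rw [hu1, mul_one]
      _ = conjLocal L (IsCMField.complexConj L) v u * conjLocal L (IsCMField.complexConj L) v b * (u * b) := by ring
      _ = 1 := h
  have huU : IsUnit u := isUnit_iff_exists_inv'.mpr ⟨_, hu1⟩
  have hbU : IsUnit b := isUnit_iff_exists_inv'.mpr ⟨_, hb1⟩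
  have hdet2 : IsUnit (u • (1 : Matrix (Fin 2) (Fin 2) (LocalRing L v))).det := isUnit_det_smul_one huU
  have hdet1 : IsUnit (b • (1 : Matrix (Fin 1) (Fin 1) (LocalRing L v))).det := isUnit_det_smul_one hbU
  let εb : (cmDatum L 2 (Matrix.of fun i j : Fin 2 => if i.val + j.val + 1 = 2 then (1 : L) else 0)).Local v ×
      (cmDatum L 1 (Matrix.of fun i j : Fin 1 => if i.val + j.val + 1 = 1 then (1 : L) else 0)).Local v :=
    (⟨Matrix.GeneralLinearGroup.mk'' _ hdet2, smul_one_mem_unitaryGroupOfForm _ _ hu1 hdet2⟩,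
      ⟨Matrix.GeneralLinearGroup.mk'' _ hdet1, smul_one_mem_unitaryGroupOfForm _ _ hb1 hdet1⟩)
  have e4 : finGammaTwo L v εb = b := by
    change (b • (1 : Matrix (Fin 1) (Fin 1) (LocalRing L v))) 0 0 = b
    rw [Matrix.smul_apply, Matrix.one_apply_eq, smul_eq_mul, mul_one]
  have e3 : finCharpolyTwo L v εb = (X - C u) * (X - C u) := by
    change (u • (1 : Matrix (Fin 2) (Fin 2) (LocalRing L v))).charpoly = _
    rw [Matrix.smul_one_eq_diagonal, Matrix.charpoly_diagonal, Fin.prod_univ_two]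
  have e5 : finCharpolyTwo L v εH = (X - C u) * (X - C b) := hfac
  refine ⟨b, εb, rfl, e4, hbu, hfac, ?_⟩
  -- the two characteristic polynomials: `(X − u)²(X − b)` both
  rw [charpoly_endoEmbLocal, charpoly_endoEmbLocal, e3, e4, e5, ← hu_def]
  ring

end CM

end Literature.NumberTheory.Rogawski1990

end
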